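import Literature.AnabelianGeometry.EtaleTheta.SettingModelChiSemidirect
import Literature.AnabelianGeometry.EtaleTheta.SettingModelLevelKernels
import Literature.AnabelianGeometry.EtaleTheta.ThetaQuotientsOfCurve
import HarnessLib

/-!
# The χ-twisted model of the [EtTh] §1 root: the theta-quotient kernels read on the levels `Heis (ℤ/N)`
# (proof-only bookkeeping for F5b / F6 / hand #2 of the R78 cluster)

Mochizuki, *The étale theta function …*, Publ. RIMS **45** (2009) [EtTh], §1, PRIMS PDF p. 12: "`Δ^Θ_X :=
Δ_X/[Δ_X,[Δ_X,Δ_X]]`", "`Δ^ell_X := Δ^ab_X`" [cite: MochizukiEtTh2009, §1 p.12].  abc-iut cell, layer L2,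
prover abc-iut-L2-d1 (gen 4), R78 cluster (χ-twisted root model; L2-lead RULINGS #13 R100); PROOF-ONLY over
abc-iut-w5-d249's carrier file `SettingModelChiSemidirect.lean` (F4: `PiHtχ = F̂₂ ⋊_χ G_{ℚ_p}`, `deltaHatχ_eq :
Δ_X = Ker(right)`), abc-iut-L6-d6's level criteria `mem_closure_commutator₂/₃_iff_forall_hHat` (F1b-1:
`[F̂₂,F̂₂]⁻`, `[[F̂₂,F̂₂],F̂₂]⁻` as joint kernels of the level maps `ĥ_N : F̂₂ → Heis (ℤ/N)`), and this seat's
`CurveTheta.ellKer/thetaKer` (the theta-quotient kernels of any tempered curve record).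

* `isClosedEmbedding_inlHatχ` — `inl : F̂₂ → F̂₂ ⋊_χ G_{ℚ_p}` is a closed embedding;
* `commutator_deltaHatχ_eq_map_inl`, `commutator₃_deltaHatχ_eq_map_inl` — `[Δ_X,Δ_X] = inl [F̂₂,F̂₂]`,
  `[[Δ_X,Δ_X],Δ_X] = inl [[F̂₂,F̂₂],F̂₂]`; hence their closures are `inl` of the closures
  (`mem_closure_commutator_deltaHatχ_iff`, `mem_closure_commutator₃_deltaHatχ_iff`);
* **`mem_ellKerχ_iff`**, **`mem_thetaKerχ_iff`** — `g ∈ Ker(Π^tp_X ↠ (Π^tp_X)^ell)` iff `g.right = 1` and every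
  level `ĥ_N(pr₁ g.left)` has `x = y = 0`; `g ∈ Ker(Π^tp_X ↠ (Π^tp_X)^Θ)` iff `g.right = 1` and every level is
  trivial — the inputs of `Sec2Hyps.ker_toEll_le_GtpYN` and `ker_toTheta_le_GtpZN` at the χ-model.
* `thetaKerχ_normal`, `ellKerχ_normal` — the `Normal` instances of `CurveTheta` RE-EXPORTED at the concrete carrier
  (instance retrieval keys the carrier: for a model given by a reducible structure literal, `(curveχ p).PiTemp`
  unfolds to `Γ ⋊ G_{ℚ_p}` and the generic instances keyed on `TemperedCurve.PiTemp _` are not found — so every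
  concrete model re-exports them; then `Group`/`IsTopologicalGroup (CurveTheta.GTheta (curveχ p))` resolve).
Semi-synthetic model, consistency evidence only; nothing of [EtTh] asserted; no side taken on [IUTchIII] Cor. 3.12.
-/

noncomputable section

namespace Literature.AnabelianGeometry.EtaleTheta.SettingModel

open Literature.AnabelianGeometry.SemiGraphs _root_.Topology _root_.Function
open scoped commutatorElement

variable (p : ℕ) [Fact p.Prime]

/-! ### `inl : F̂₂ → Π_X` is a closed embedding -/

/-- `inl : F̂₂ → F̂₂ ⋊_χ G_{ℚ_p}` is a closed embedding (inducing — `(left, right) ∘ inl = (·, 1)` — injective, with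
closed image `Ker(right)`). [cite: MochizukiEtTh2009, §1 p.12] -/
theorem isClosedEmbedding_inlHatχ :
    IsClosedEmbedding (SemidirectProduct.inl : F₂hatT → PiHtχ p) := by
  have h1 : IsInducing (fun x : F₂hatT => (x, (1 : GQp p))) :=
    IsInducing.of_comp (continuous_id.prodMk continuous_const) continuous_fst IsInducing.id
  have hcomp : (fun g : PiHtχ p => (g.left, g.right)) ∘ (SemidirectProduct.inl : F₂hatT → PiHtχ p) =
      fun x => (x, (1 : GQp p)) := by
    funext x
    simp
  have hind : IsInducing (SemidirectProduct.inl : F₂hatT → PiHtχ p) := by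
    rw [← (isInducing_leftRightHatχ p).of_comp_iff, hcomp]
    exact h1
  refine ⟨⟨hind, SemidirectProduct.inl_injective⟩, ?_⟩
  rw [← MonoidHom.coe_range, SemidirectProduct.range_inl_eq_ker_rightHom]
  exact isClosed_ker_rightHomHatχ p

/-! ### The commutator subgroups of `Δ_X = F̂₂ ⋊ 1` -/

/-- `Δ_X = inl(F̂₂)` as the image of `⊤`. [cite: MochizukiEtTh2009, §1 p.12] -/
theorem deltaHatχ_eq_map_inl :
    (curveχ p).DeltaHat = (⊤ : Subgroup F₂hatT).map (SemidirectProduct.inl : F₂hatT →* PiHtχ p) := by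
  rw [deltaHatχ_eq, ← SemidirectProduct.range_inl_eq_ker_rightHom, MonoidHom.range_eq_map]

/-- `[Δ_X, Δ_X] = inl [F̂₂, F̂₂]`. [cite: MochizukiEtTh2009, §1 p.12] -/
theorem commutator_deltaHatχ_eq_map_inl :
    ⁅(curveχ p).DeltaHat, (curveχ p).DeltaHat⁆ =
      (⁅(⊤ : Subgroup F₂hatT), (⊤ : Subgroup F₂hatT)⁆).map (SemidirectProduct.inl : F₂hatT →* PiHtχ p) := by
  rw [deltaHatχ_eq_map_inl, Subgroup.map_commutator]

/-- `[[Δ_X, Δ_X], Δ_X] = inl [[F̂₂, F̂₂], F̂₂]`. [cite: MochizukiEtTh2009, §1 p.12] -/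
theorem commutator₃_deltaHatχ_eq_map_inl :
    ⁅⁅(curveχ p).DeltaHat, (curveχ p).DeltaHat⁆, (curveχ p).DeltaHat⁆ =
      (⁅⁅(⊤ : Subgroup F₂hatT), (⊤ : Subgroup F₂hatT)⁆, (⊤ : Subgroup F₂hatT)⁆).map
        (SemidirectProduct.inl : F₂hatT →* PiHtχ p) := by
  rw [deltaHatχ_eq_map_inl, Subgroup.map_commutator, Subgroup.map_commutator]

/-- Closures pass through the closed embedding `inl`: membership in `cl (inl H)` is membership of the `left`
component in `cl H` together with `right = 1`. [cite: MochizukiEtTh2009, §1 p.12] -/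
theorem mem_topologicalClosure_map_inl_iff (H : Subgroup F₂hatT) (y : PiHtχ p) :
    y ∈ (H.map (SemidirectProduct.inl : F₂hatT →* PiHtχ p)).topologicalClosure ↔
      y.left ∈ H.topologicalClosure ∧ y.right = 1 := by
  rw [← SetLike.mem_coe, Subgroup.topologicalClosure_coe, Subgroup.coe_map,
    (isClosedEmbedding_inlHatχ p).closure_image_eq, ← Subgroup.topologicalClosure_coe]
  constructor
  · rintro ⟨x, hx, rfl⟩
    have hx' : x ∈ H.topologicalClosure := hx
    exact ⟨by rwa [SemidirectProduct.left_inl], by rw [SemidirectProduct.right_inl]⟩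
  · rintro ⟨h1, h2⟩
    refine ⟨y.left, (h1 : y.left ∈ (H.topologicalClosure : Set F₂hatT)), ?_⟩
    rw [← SemidirectProduct.inl_left_mul_inr_right y, h2, map_one, mul_one]
    simp

/-- **Membership in `[Δ_X,Δ_X]⁻`** read on `F̂₂`: `left ∈ [F̂₂,F̂₂]⁻` and `right = 1`. [cite: MochizukiEtTh2009, §1 p.12] -/
theorem mem_closure_commutator_deltaHatχ_iff (y : PiHtχ p) :
    y ∈ (⁅(curveχ p).DeltaHat, (curveχ p).DeltaHat⁆).topologicalClosure ↔
      y.left ∈ (⁅(⊤ : Subgroup F₂hatT), (⊤ : Subgroup F₂hatT)⁆).topologicalClosure ∧ y.right = 1 := by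
  rw [commutator_deltaHatχ_eq_map_inl]
  exact mem_topologicalClosure_map_inl_iff p _ y

/-- **Membership in `[[Δ_X,Δ_X],Δ_X]⁻`** read on `F̂₂`. [cite: MochizukiEtTh2009, §1 p.12] -/
theorem mem_closure_commutator₃_deltaHatχ_iff (y : PiHtχ p) :
    y ∈ (⁅⁅(curveχ p).DeltaHat, (curveχ p).DeltaHat⁆, (curveχ p).DeltaHat⁆).topologicalClosure ↔
      y.left ∈ (⁅⁅(⊤ : Subgroup F₂hatT), (⊤ : Subgroup F₂hatT)⁆, (⊤ : Subgroup F₂hatT)⁆).topologicalClosure ∧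
        y.right = 1 := by
  rw [commutator₃_deltaHatχ_eq_map_inl]
  exact mem_topologicalClosure_map_inl_iff p _ y

/-! ### The theta-quotient kernels of `curveχ` on the levels -/

/-- **`Ker(Π^tp_X ↠ (Π^tp_X)^ell)` at the χ-model** (`CurveTheta.ellKer (curveχ p)`): `g.right = 1` and every level
`ĥ_N(pr₁ g.left) ∈ Heis (ℤ/N)` has `x = y = 0` ("`Δ^ell_X := Δ^ab_X`", p. 12). [cite: MochizukiEtTh2009, §1 p.12] -/
theorem mem_ellKerχ_iff (g : PiTpχ p) :
    g ∈ CurveTheta.ellKer (curveχ p) ↔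
      (∀ N : ℕ+, (hHat N (gfpFst g.left)).x = 0 ∧ (hHat N (gfpFst g.left)).y = 0) ∧ g.right = 1 := by
  change toHatχ p g ∈ (⁅(curveχ p).DeltaHat, (curveχ p).DeltaHat⁆).topologicalClosure ↔ _
  rw [mem_closure_commutator_deltaHatχ_iff, toHatχ_left, toHatχ_right, mem_closure_commutator₂_iff_forall_hHat]

/-- **`Ker(Π^tp_X ↠ (Π^tp_X)^Θ)` at the χ-model** (`CurveTheta.thetaKer (curveχ p)`): `g.right = 1` and every level
`ĥ_N(pr₁ g.left)` is trivial ("`Δ^Θ_X := Δ_X/[Δ_X,[Δ_X,Δ_X]]`", p. 12). [cite: MochizukiEtTh2009, §1 p.12] -/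
theorem mem_thetaKerχ_iff (g : PiTpχ p) :
    g ∈ CurveTheta.thetaKer (curveχ p) ↔ (∀ N : ℕ+, hHat N (gfpFst g.left) = 1) ∧ g.right = 1 := by
  change toHatχ p g ∈ (⁅⁅(curveχ p).DeltaHat, (curveχ p).DeltaHat⁆, (curveχ p).DeltaHat⁆).topologicalClosure ↔ _
  rw [mem_closure_commutator₃_deltaHatχ_iff, toHatχ_left, toHatχ_right, mem_closure_commutator₃_iff_forall_hHat]

/-- In particular `Ker(Π^tp_X ↠ (Π^tp_X)^Θ)` has trivial Galois component and trivial degree: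
`g.right = 1` and `pr₂ g.left = 1` (`ê(pr₁ g.left) = 1` from the vanishing `x`-coordinates).
[cite: MochizukiEtTh2009, §1 p.12] -/
theorem right_eq_one_of_mem_ellKerχ {g : PiTpχ p} (hg : g ∈ CurveTheta.ellKer (curveχ p)) : g.right = 1 :=
  ((mem_ellKerχ_iff p g).mp hg).2

/-! ### The `Normal` instances at the concrete carrier (instance-retrieval keys) -/

/-- `Ker(Π^tp_X ↠ (Π^tp_X)^Θ) ⊴ Π^tp_X` at the χ-model — abc-iut-L2-d1's generic `CurveTheta.thetaKer_normal`
re-exported at the concrete carrier `Γ ⋊_χ G_{ℚ_p}` so that instance search finds it (and hence the group and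
topological-group structures of `CurveTheta.GTheta (curveχ p)`). [cite: MochizukiEtTh2009, §1 p.12] -/
instance thetaKerχ_normal : (CurveTheta.thetaKer (curveχ p)).Normal := CurveTheta.thetaKer_normal _

/-- `Ker(Π^tp_X ↠ (Π^tp_X)^ell) ⊴ Π^tp_X` at the χ-model (same remark). [cite: MochizukiEtTh2009, §1 p.12] -/
instance ellKerχ_normal : (CurveTheta.ellKer (curveχ p)).Normal := CurveTheta.ellKer_normal _

/-- Sanity: `(Π^tp_X)^Θ` of the χ-model is a topological group (quotient topology), found by instance search.
[cite: MochizukiEtTh2009, §1 p.12] -/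
theorem isTopologicalGroup_GThetaχ : IsTopologicalGroup (CurveTheta.GTheta (curveχ p)) := inferInstance

/-- `Ker((Π^tp_X)^Θ ↠ (Π^tp_X)^ell ∘ Π^tp_X ↠ (Π^tp_X)^Θ) = ellKer` at the χ-model (the root field `ker_toEll` shape).
[cite: MochizukiEtTh2009, §1 p.12] -/
theorem ker_thetaToEll_comp_toThetaχ :
    ((CurveTheta.thetaToEll (curveχ p)).comp (CurveTheta.toTheta (curveχ p))).ker = CurveTheta.ellKer (curveχ p) :=
  CurveTheta.ker_toEll _

end Literature.AnabelianGeometry.EtaleTheta.SettingModel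

end
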